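import Summits.BirchSwinnertonDyer.Rank1Residual.GaloisImage.ComparisonOperatorLevelChange
import HarnessLib

/-!
# The canonical finite–singular comparison maps at two levels `N₁ ∣ N₂` are compatible
# (cell `b2b-bsdres`, team n1011, seat p15 GEN 4, OWNERS row T-INJ-DEV, file F-B1b;
# skeleton `cells/n1011/skel/T-INJ-DEV.md`)

HONEST FRAMING (cell `b2b-bsdres`, run/shared/lean/b2b/bsd-rank1-residual/, verbatim in every
file): the goal of the cell is to DELETE the COMBINATION-SHAPED residual classes of the
Birch–Swinnerton-Dyer formula for ALL analytic-rank `≤ 1` elliptic curves over `ℚ` — "full BSD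
formula for every rank `≤ 1` curve in class `C`" assembled STRICTLY from published theorems — so
that the rank-`≤ 1` remainder becomes exactly the CONSTRUCTION-SHAPED classes, which are TYPED
(missing-input `Prop`s), NOT attempted. This is not "finishing BSD". Team n1011 (N10 / N11, the
additive block X4 ∧ `p = 3`): research route on the CONSTRUCTION-SHAPED class X4; TOOL theorems of
local Galois cohomology; no class theorem; nothing is booked; no label and no RESIDUAL-MAP mark is
moved. Theorems only: no definition, no named fact, no `sorry`.

## What and why

The dévissage of file F-A (`KolyvaginInjectivityDevissage`) transports Kolyvagin systems along a
reduction `red : M → N` and lifts them along an inclusion `incl : N → M` (intended `M = E[p²]`,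
`N = E[p]`, or any pair of truncations); its finite–singular hypotheses `hfsπ` / `hfsi` say that the
comparison maps `φ^{fs}_𝔮` of the two Kolyvagin data are compatible with `red_*` / `incl_*` on
unramified classes.  Here they are PROVED, over `ℚ`, when BOTH data carry THE CANONICAL comparison
maps (Rubin Def. 1.9.6 in Kim's generator-fixed form, the tree's `HasCanonicalComparison`) with the
SAME primitive roots `η`, at levels `N₂` on `M` and `N₁ ∣ N₂` on `N`, at any prime `𝔮` of both data
where both modules are unramified, whenever `red` carries a `ℤ/N₂`-basis of `M` to a `ℤ/N₁`-basis of
`N` (then `Q_N(φ⁻¹) = Q_M(φ⁻¹) mod N₁`, sibling file F-B1a):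

* **`singularMap_localMap_eq_fs_of_hasCanonicalComparison`** — TRANSPORT along `red`:
  `w ≡ φ^{fs}_𝔮(y) mod H¹_ur ⟹ red_* w ≡ φ^{fs}_𝔮(red_* y) mod H¹_ur`;
* **`singularMap_eq_fs_of_localMap_of_hasCanonicalComparison`** — REFLECTION along an injective
  equivariant `incl`: `incl_* w ≡ φ^{fs}_𝔮(incl_* y) ⟹ w ≡ φ^{fs}_𝔮(y)`.
Proof: on cocycles `w(τ) = Q(φ⁻¹) z(φ)` at every inertia `τ` over `η_𝔮`; two cocycles agreeing on
the `η_𝔮`-fibre of inertia differ by an unramified class (F-B1a §1).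

References: K. Rubin, PCMI 18 (2011) Def. 1.9.6, Prop. 1.9.5 [Rubin2011]; C.-H. Kim, AJM 148
(2026) §2.1.2, §2.2.2 [Kim2022StructureSelmer]; J.-P. Serre, *Local Fields* IV §4 Prop. 17.
-/

noncomputable section

open Field Polynomial Module
open Literature.NumberTheory.GaloisRepresentations
open Literature.NumberTheory.GaloisRepresentations.DiscreteGaloisModule
open Literature.NumberTheory.GaloisCohomology
open scoped ContRepresentation Polynomial NumberField

universe u

namespace Summit.BirchSwinnertonDyer.Rank1Residual.GaloisImage.KSDevissage

/-! ### §3 Over `ℚ`: canonical comparison maps at two levels are compatible -/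

section Canonical

open NumberField IsDedekindDomain

variable {M : Type} [AddCommGroup M] [TopologicalSpace M] [DiscreteTopology M]
  {N : Type} [AddCommGroup N] [TopologicalSpace N] [DiscreteTopology N]
  {ρM : DiscreteGaloisModule ℚ M} {ρN : DiscreteGaloisModule ℚ N}
  {N₁ N₂ : ℕ} [Fact (1 < N₁)] [NeZero N₂]
  [Module (ZMod N₂) M] [Module.Free (ZMod N₂) M] [Module.Finite (ZMod N₂) M]
  [Module (ZMod N₁) N] [Module.Free (ZMod N₁) N] [Module.Finite (ZMod N₁) N]

omit [Fact (1 < N₁)] [NeZero N₂] [Module (ZMod N₂) M] [Module.Free (ZMod N₂) M]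
  [Module.Finite (ZMod N₂) M] [Module (ZMod N₁) N] [Module.Free (ZMod N₁) N]
  [Module.Finite (ZMod N₁) N] in
/-- `f_* [ξ] = [f ∘ ξ]` at a finite place, for the local map `localMap f (Sum.inr q)` of an
equivariant `f : M → N`. [folklore] -/
theorem localMap_inr_oneCocycleClass (f : ρM.toContRepresentation →ⁱL ρN.toContRepresentation)
    (q : HeightOneSpectrum (𝓞 ℚ)) (ξ : contOneCocycles (GaloisRep.toLocal q ρM).toTopRep) :
    localMap f (Sum.inr q) (oneCocycleClass (GaloisRep.toLocal q ρM).toTopRep ξ) =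
      oneCocycleClass (GaloisRep.toLocal q ρN).toTopRep
        (contOneCocycles.pullback (ContinuousMonoidHom.id _)
          (X := (GaloisRep.toLocal q ρM).toTopRep) (Y := (GaloisRep.toLocal q ρN).toTopRep)
          (TopRep.ofHom ⟨(f.restrictField (q.adicCompletion ℚ)).toContinuousLinearMap,
            (f.restrictField (q.adicCompletion ℚ)).isIntertwining'⟩) ξ) :=
  galoisCohomology.map_one_oneCocycleClass _ ξ

omit [Fact (1 < N₁)] [NeZero N₂] [Module (ZMod N₂) M] [Module.Free (ZMod N₂) M]
  [Module.Finite (ZMod N₂) M] [Module (ZMod N₁) N] [Module.Free (ZMod N₁) N]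
  [Module.Finite (ZMod N₁) N] in
/-- An inertia element of `Γ_{ℚ_q}` over Kim's primitive root `η_𝔮` (Serre LF IV §4 Prop. 17, tree
`modPCyclotomicCharacter_surjOn_absInertia_rat_holds`). [cite: SerreLocalFields1979, IV §4 Prop. 17] -/
theorem exists_absInertia_localNormCyclotomicCharacter_eq (q : HeightOneSpectrum (𝓞 ℚ))
    (u : (ZMod (Ideal.absNorm q.asIdeal))ˣ) :
    ∃ t ∈ absInertia (q.adicCompletion ℚ), localNormCyclotomicCharacter q t = u := by
  haveI : Fact (Ideal.absNorm q.asIdeal).Prime := ⟨FSComp.prime_absNorm_rat q⟩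
  haveI : CharZero (q.adicCompletion ℚ) :=
    charZero_of_injective_algebraMap (algebraMap ℚ (q.adicCompletion ℚ)).injective
  haveI : NeZero ((Ideal.absNorm q.asIdeal : ℕ) : q.adicCompletion ℚ) :=
    ⟨Nat.cast_ne_zero.2 (Fact.out : (Ideal.absNorm q.asIdeal).Prime).ne_zero⟩
  obtain ⟨t, ht, hχt⟩ := modPCyclotomicCharacter_surjOn_absInertia_rat_holds q u
  exact ⟨t, ht, by rw [FSComp.localNormCyclotomicCharacter_eq_modPCyclotomicCharacterZMod]; exact hχt⟩

/-- **TRANSPORT of the canonical comparison maps along a reduction `red : M → N`** (the hypothesis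
`hfsπ` of `KSDevissage.apply_eq_zero_of_apply_eq_zero_of_devissage`).  Over `ℚ`, let `D_M`
(level `N₂`) and `D_N` (level `N₁ ∣ N₂`) carry THE canonical comparison maps with the same primitive
roots `η` (`HasCanonicalComparison`), let `𝔮` be a prime of both data at which `M` and `N` are
unramified, and let `red` be equivariant, `ℤ/N₂ → ℤ/N₁`-semilinear and carry a basis to a basis.
If `w` represents `φ^{fs}_𝔮(y)` modulo `H¹_ur(ℚ_𝔮, M)` for an unramified `y`, then `red_* w`
represents `φ^{fs}_𝔮(red_* y)` modulo `H¹_ur(ℚ_𝔮, N)`: on cocycles, `w(τ) = Q_M(φ⁻¹) z(φ)` and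
`Q_N(φ⁻¹) ∘ red = red ∘ Q_M(φ⁻¹)` give `(red ∘ w)(τ) = w₃(τ)` for any representative `w₃` of
`φ^{fs}(red_* y)` and every inertia `τ` over `η_𝔮`, so `red ∘ w − w₃` is unramified (§1).
[cite: Rubin2011, Def. 1.9.6 (p. 14)] [cite: Kim2022StructureSelmer, §2.1.2 and §2.2.2] -/
theorem singularMap_localMap_eq_fs_of_hasCanonicalComparison (hdvd : N₁ ∣ N₂)
    (red : ρM.toContRepresentation →ⁱL ρN.toContRepresentation)
    {ι : Type*} [Fintype ι] [DecidableEq ι] (b : Basis ι (ZMod N₂) M) (b' : Basis ι (ZMod N₁) N)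
    (hb : ∀ i, red (b i) = b' i)
    {DM : KolyvaginDatum ρM} {DN : KolyvaginDatum ρN}
    {η : (q : HeightOneSpectrum (𝓞 ℚ)) → (ZMod (Ideal.absNorm q.asIdeal))ˣ}
    (hDM : DM.HasCanonicalComparison N₂ η) (hDN : DN.HasCanonicalComparison N₁ η)
    {q : HeightOneSpectrum (𝓞 ℚ)} (hqM : q ∈ DM.primes) (hqN : q ∈ DN.primes)
    (hurM : GaloisRep.IsUnramifiedAt q ρM) (hurN : GaloisRep.IsUnramifiedAt q ρN)
    {y : galoisCohomology (GaloisRep.toLocal q ρM) 1}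
    (hy : y ∈ unramifiedSubgroup (GaloisRep.toLocal q ρM) 1)
    (w : galoisCohomology (GaloisRep.toLocal q ρM) 1)
    (hw : singularMap (GaloisRep.toLocal q ρM) w = DM.fs q y) :
    singularMap (GaloisRep.toLocal q ρN) (localMap red (Sum.inr q) w) =
      DN.fs q (localMap red (Sum.inr q) y) := by
  classical
  set L := q.adicCompletion ℚ
  have hIM : ∀ t ∈ absInertia L, GaloisRep.toLocal q ρM t = 1 := fun t ht =>
    (GaloisRep.isUnramifiedAt_iff_toLocal_holds q ρM).1 hurM t ht
  have hIN : ∀ t ∈ absInertia L, GaloisRep.toLocal q ρN t = 1 := fun t ht =>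
    (GaloisRep.isUnramifiedAt_iff_toLocal_holds q ρN).1 hurN t ht
  have hIM' : ∀ t ∈ absInertia L, ∀ m : M, GaloisRep.toLocal q ρM t m = m := fun t ht m => by
    rw [hIM t ht, Module.End.one_apply]
  have hIN' : ∀ t ∈ absInertia L, ∀ n : N, GaloisRep.toLocal q ρN t n = n := fun t ht n => by
    rw [hIN t ht, Module.End.one_apply]
  have hρ : ∀ (σ : absoluteGaloisGroup L) (m : M),
      red (GaloisRep.toLocal q ρM σ m) = GaloisRep.toLocal q ρN σ (red m) := fun σ m =>
    red.isIntertwining _ m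
  obtain ⟨φ, hφ⟩ := exists_isAbsArithFrob_holds (F := L)
  have hgen : Subgroup.zpowers (η q) = ⊤ := hDN.zpowers_eq_top hqN
  have hfib := exists_absInertia_localNormCyclotomicCharacter_eq q (η q)
  -- representatives
  obtain ⟨z, rfl⟩ := oneCocycleClass_surjective (GaloisRep.toLocal q ρM).toTopRep y
  obtain ⟨wt, rfl⟩ := oneCocycleClass_surjective (GaloisRep.toLocal q ρM).toTopRep w
  rw [localMap_inr_oneCocycleClass, localMap_inr_oneCocycleClass]
  set z' := contOneCocycles.pullback (ContinuousMonoidHom.id _)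
    (X := (GaloisRep.toLocal q ρM).toTopRep) (Y := (GaloisRep.toLocal q ρN).toTopRep)
    (TopRep.ofHom ⟨(red.restrictField L).toContinuousLinearMap,
      (red.restrictField L).isIntertwining'⟩) z with hz'_def
  set wt' := contOneCocycles.pullback (ContinuousMonoidHom.id _)
    (X := (GaloisRep.toLocal q ρM).toTopRep) (Y := (GaloisRep.toLocal q ρN).toTopRep)
    (TopRep.ofHom ⟨(red.restrictField L).toContinuousLinearMap,
      (red.restrictField L).isIntertwining'⟩) wt with hwt'_def
  have hz'app : ∀ g, z'.1 g = red (z.1 g) := fun g => rfl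
  have hwt'app : ∀ g, wt'.1 g = red (wt.1 g) := fun g => rfl
  -- `z` and `red ∘ z` vanish on inertia
  have hz0 : ∀ t ∈ absInertia L, z.1 t = 0 :=
    (X11b.LocBridge.mem_unramifiedSubgroup_one_iff_forall_eq_zero _ hIM' z).mp hy
  have hz'ur : oneCocycleClass (GaloisRep.toLocal q ρN).toTopRep z' ∈
      unramifiedSubgroup (GaloisRep.toLocal q ρN) 1 :=
    (X11b.LocBridge.mem_unramifiedSubgroup_one_iff_forall_eq_zero _ hIN' z').mpr fun t ht => by
      rw [hz'app, hz0 t ht, map_zero]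
  -- a representative `w₃` of `φ^{fs}(red_* y)`
  obtain ⟨c₃, hc₃⟩ := QuotientAddGroup.mk_surjective
    (DN.fs q (oneCocycleClass (GaloisRep.toLocal q ρN).toTopRep z'))
  obtain ⟨w₃, rfl⟩ := oneCocycleClass_surjective (GaloisRep.toLocal q ρN).toTopRep c₃
  have hw₃ : singularMap (GaloisRep.toLocal q ρN) (oneCocycleClass _ w₃) = DN.fs q (oneCocycleClass _ z') :=
    hc₃
  -- `red ∘ w − w₃` vanishes on the `η`-fibre of inertia, hence on inertia
  have hvan : ∀ t ∈ absInertia L, (wt' - w₃).1 t = 0 := by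
    refine forall_absInertia_apply_eq_zero_of_fibre (GaloisRep.toLocal q ρN) hIN
      (localNormCyclotomicCharacter q) hgen hfib (wt' - w₃) fun t ht hχt => ?_
    have hM := (hDM.at hqM hφ ht hχt).apply_eq z wt hy hw
    have hN := (hDN.at hqN hφ ht hχt).apply_eq z' w₃ hz'ur hw₃
    rw [Submodule.coe_sub, ContinuousMap.sub_apply, hwt'app, hN, hz'app, hM, sub_eq_zero]
    exact apply_comparisonOp_eq (GaloisRep.toLocal q ρM) (GaloisRep.toLocal q ρN) hdvd b b'
      red.toContinuousLinearMap.toLinearMap.toAddMonoidHom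
      (map_zmod_smul_eq_castHom_smul hdvd red.toContinuousLinearMap.toLinearMap.toAddMonoidHom) hb hρ φ (z.1 φ)
  have hur : oneCocycleClass (GaloisRep.toLocal q ρN).toTopRep (wt' - w₃) ∈
      unramifiedSubgroup (GaloisRep.toLocal q ρN) 1 :=
    (X11b.LocBridge.mem_unramifiedSubgroup_one_iff_forall_eq_zero _ hIN' _).mpr hvan
  rw [← hw₃]
  exact (FSComp.singularMap_oneCocycleClass_eq_iff (GaloisRep.toLocal q ρN) wt' w₃).mpr hur

/-- **REFLECTION of the canonical comparison maps along an injective `incl : N → M`** (the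
hypothesis `hfsi` of `KSDevissage.apply_eq_zero_of_apply_eq_zero_of_devissage`).  Same setting
(the reduction `red` supplies `Q_N = Q_M mod N₁`); `incl` equivariant, injective, with the
`ℤ/N₂`-action on its image factoring through `ℤ/N₁`.  If `incl_* w` represents
`φ^{fs}_𝔮(incl_* y)` modulo `H¹_ur(ℚ_𝔮, M)` for an unramified `y ∈ H¹(ℚ_𝔮, N)`, then `w` represents
`φ^{fs}_𝔮(y)` modulo `H¹_ur(ℚ_𝔮, N)`: `incl (w(τ)) = Q_M(φ⁻¹) incl(z(φ)) = incl (Q_N(φ⁻¹) z(φ))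
= incl (w₁(τ))` for a representative `w₁` of `φ^{fs}(y)`, so `w − w₁` is unramified (§1).
[cite: Rubin2011, Def. 1.9.6 (p. 14)] [cite: Kim2022StructureSelmer, §2.1.2 and §2.2.2] -/
theorem singularMap_eq_fs_of_localMap_of_hasCanonicalComparison (hdvd : N₁ ∣ N₂)
    (red : ρM.toContRepresentation →ⁱL ρN.toContRepresentation)
    {ι : Type*} [Fintype ι] [DecidableEq ι] (b : Basis ι (ZMod N₂) M) (b' : Basis ι (ZMod N₁) N)
    (hb : ∀ i, red (b i) = b' i)
    (incl : ρN.toContRepresentation →ⁱL ρM.toContRepresentation) (hinj : Function.Injective incl)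
    {DM : KolyvaginDatum ρM} {DN : KolyvaginDatum ρN}
    {η : (q : HeightOneSpectrum (𝓞 ℚ)) → (ZMod (Ideal.absNorm q.asIdeal))ˣ}
    (hDM : DM.HasCanonicalComparison N₂ η) (hDN : DN.HasCanonicalComparison N₁ η)
    {q : HeightOneSpectrum (𝓞 ℚ)} (hqM : q ∈ DM.primes) (hqN : q ∈ DN.primes)
    (hurM : GaloisRep.IsUnramifiedAt q ρM) (hurN : GaloisRep.IsUnramifiedAt q ρN)
    {y : galoisCohomology (GaloisRep.toLocal q ρN) 1}
    (hy : y ∈ unramifiedSubgroup (GaloisRep.toLocal q ρN) 1)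
    (w : galoisCohomology (GaloisRep.toLocal q ρN) 1)
    (hw : singularMap (GaloisRep.toLocal q ρM) (localMap incl (Sum.inr q) w) =
      DM.fs q (localMap incl (Sum.inr q) y)) :
    singularMap (GaloisRep.toLocal q ρN) w = DN.fs q y := by
  classical
  set L := q.adicCompletion ℚ
  have hIM : ∀ t ∈ absInertia L, GaloisRep.toLocal q ρM t = 1 := fun t ht =>
    (GaloisRep.isUnramifiedAt_iff_toLocal_holds q ρM).1 hurM t ht
  have hIN : ∀ t ∈ absInertia L, GaloisRep.toLocal q ρN t = 1 := fun t ht =>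
    (GaloisRep.isUnramifiedAt_iff_toLocal_holds q ρN).1 hurN t ht
  have hIM' : ∀ t ∈ absInertia L, ∀ m : M, GaloisRep.toLocal q ρM t m = m := fun t ht m => by
    rw [hIM t ht, Module.End.one_apply]
  have hIN' : ∀ t ∈ absInertia L, ∀ n : N, GaloisRep.toLocal q ρN t n = n := fun t ht n => by
    rw [hIN t ht, Module.End.one_apply]
  have hρred : ∀ (σ : absoluteGaloisGroup L) (m : M),
      red (GaloisRep.toLocal q ρM σ m) = GaloisRep.toLocal q ρN σ (red m) := fun σ m =>
    red.isIntertwining _ m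
  have hρincl : ∀ (σ : absoluteGaloisGroup L) (n : N),
      GaloisRep.toLocal q ρM σ (incl n) = incl (GaloisRep.toLocal q ρN σ n) := fun σ n =>
    (incl.isIntertwining _ n).symm
  obtain ⟨φ, hφ⟩ := exists_isAbsArithFrob_holds (F := L)
  have hgen : Subgroup.zpowers (η q) = ⊤ := hDN.zpowers_eq_top hqN
  have hfib := exists_absInertia_localNormCyclotomicCharacter_eq q (η q)
  have hQ : ∀ φ : absoluteGaloisGroup L,
      DiscreteGaloisModule.comparisonQ (GaloisRep.toLocal q ρN) N₁ φ =
        (DiscreteGaloisModule.comparisonQ (GaloisRep.toLocal q ρM) N₂ φ).map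
          (ZMod.castHom hdvd (ZMod N₁)) := fun φ =>
    (comparisonQ_eq_map (GaloisRep.toLocal q ρM) (GaloisRep.toLocal q ρN) hdvd b b'
      red.toContinuousLinearMap.toLinearMap.toAddMonoidHom
      (map_zmod_smul_eq_castHom_smul hdvd red.toContinuousLinearMap.toLinearMap.toAddMonoidHom) hb φ (hρred φ)).2
  -- representatives
  obtain ⟨z, rfl⟩ := oneCocycleClass_surjective (GaloisRep.toLocal q ρN).toTopRep y
  obtain ⟨wt, rfl⟩ := oneCocycleClass_surjective (GaloisRep.toLocal q ρN).toTopRep w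
  rw [localMap_inr_oneCocycleClass, localMap_inr_oneCocycleClass] at hw
  set z' := contOneCocycles.pullback (ContinuousMonoidHom.id _)
    (X := (GaloisRep.toLocal q ρN).toTopRep) (Y := (GaloisRep.toLocal q ρM).toTopRep)
    (TopRep.ofHom ⟨(incl.restrictField L).toContinuousLinearMap,
      (incl.restrictField L).isIntertwining'⟩) z with hz'_def
  set wt' := contOneCocycles.pullback (ContinuousMonoidHom.id _)
    (X := (GaloisRep.toLocal q ρN).toTopRep) (Y := (GaloisRep.toLocal q ρM).toTopRep)
    (TopRep.ofHom ⟨(incl.restrictField L).toContinuousLinearMap,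
      (incl.restrictField L).isIntertwining'⟩) wt with hwt'_def
  have hz'app : ∀ g, z'.1 g = incl (z.1 g) := fun g => rfl
  have hwt'app : ∀ g, wt'.1 g = incl (wt.1 g) := fun g => rfl
  have hz0 : ∀ t ∈ absInertia L, z.1 t = 0 :=
    (X11b.LocBridge.mem_unramifiedSubgroup_one_iff_forall_eq_zero _ hIN' z).mp hy
  have hz'ur : oneCocycleClass (GaloisRep.toLocal q ρM).toTopRep z' ∈
      unramifiedSubgroup (GaloisRep.toLocal q ρM) 1 :=
    (X11b.LocBridge.mem_unramifiedSubgroup_one_iff_forall_eq_zero _ hIM' z').mpr fun t ht => by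
      rw [hz'app, hz0 t ht, map_zero]
  -- a representative `w₁` of `φ^{fs}(y)`
  obtain ⟨c₁, hc₁⟩ := QuotientAddGroup.mk_surjective
    (DN.fs q (oneCocycleClass (GaloisRep.toLocal q ρN).toTopRep z))
  obtain ⟨w₁, rfl⟩ := oneCocycleClass_surjective (GaloisRep.toLocal q ρN).toTopRep c₁
  have hw₁ : singularMap (GaloisRep.toLocal q ρN) (oneCocycleClass _ w₁) = DN.fs q (oneCocycleClass _ z) :=
    hc₁
  -- `w − w₁` vanishes on the `η`-fibre of inertia, hence on inertia
  have hvan : ∀ t ∈ absInertia L, (wt - w₁).1 t = 0 := by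
    refine forall_absInertia_apply_eq_zero_of_fibre (GaloisRep.toLocal q ρN) hIN
      (localNormCyclotomicCharacter q) hgen hfib (wt - w₁) fun t ht hχt => ?_
    have hM := (hDM.at hqM hφ ht hχt).apply_eq z' wt' hz'ur hw
    have hN := (hDN.at hqN hφ ht hχt).apply_eq z w₁ hy hw₁
    have hop : DiscreteGaloisModule.comparisonOp (GaloisRep.toLocal q ρM) N₂ φ (incl (z.1 φ)) =
        incl (DiscreteGaloisModule.comparisonOp (GaloisRep.toLocal q ρN) N₁ φ (z.1 φ)) :=
      comparisonOp_apply_eq_of_incl (GaloisRep.toLocal q ρM) (GaloisRep.toLocal q ρN) hdvd hQ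
        incl.toContinuousLinearMap.toLinearMap.toAddMonoidHom
        (zmod_smul_map_eq_map_castHom_smul hdvd incl.toContinuousLinearMap.toLinearMap.toAddMonoidHom)
        hρincl φ (z.1 φ)
    rw [hwt'app, hz'app, hop, ← hN] at hM
    rw [Submodule.coe_sub, ContinuousMap.sub_apply, sub_eq_zero]
    exact hinj hM
  have hur : oneCocycleClass (GaloisRep.toLocal q ρN).toTopRep (wt - w₁) ∈
      unramifiedSubgroup (GaloisRep.toLocal q ρN) 1 :=
    (X11b.LocBridge.mem_unramifiedSubgroup_one_iff_forall_eq_zero _ hIN' _).mpr hvan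
  rw [← hw₁]
  exact (FSComp.singularMap_oneCocycleClass_eq_iff (GaloisRep.toLocal q ρN) wt w₁).mpr hur

end Canonical

end Summit.BirchSwinnertonDyer.Rank1Residual.GaloisImage.KSDevissage

end
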